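import Literature.NumberTheory.Automorphic.WhittakerCoeffCuspidal
import Literature.NumberTheory.Automorphic.GLnCuspidalSpectrumProofs
import HarnessLib

/-!
# Whittaker coefficients of `L²`-classes through continuous representatives: translates and sums

Topic `NumberTheory/Automorphic`; namespace `Literature.NumberTheory.Automorphic`. Proof file
(theorems only). Small dictionary between vectors `x ∈ L²(GL_n(K) A \ GL_n(𝔸_K))` with a continuous
representative `F` (`x = F` a.e.) and the global Whittaker coefficients of `invQuot F`
(`GlobalWhittakerCoefficient`, `WhittakerCoeffLocalDatum`):

* `rightRegular_ae_eq_comp_inv_smul` — `R(h) x` is represented by `F(h⁻¹ • ·)`;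
* `coeFn_finset_sum_ae_eq` — finite sums of classes are represented by the sums of representatives;
* `whittakerCoeff_invQuot_comp_toAdelic_inv_smul` — `W_{F(ι_v(X)⁻¹ • ·)}(g) = W_F(g ι_v(X))`
  (`whittakerCoeff_mul_right`, `invQuot_mul_eq_smul`; Whittaker side in the `GL (Fin n) 𝔸_K` spelling
  `GLn.ofLocal`, action in the spelling `GLn.toAdelic` — the same map);
* `whittakerCoeff_invQuot_mul_ofLocal_eq_of_rightRegular_eq_self` — **invariant vectors have invariant
  Whittaker coefficients**: if `R(ι_v X) x = x` then `W_F(g ι_v(X)) = W_F(g)` for every `g` (the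
  continuous representatives of `R(ι_v X) x` and `x` agree everywhere, `μ` charging open sets).

[folklore]
-/

noncomputable section

open MeasureTheory Measure Set Filter Topology IsDedekindDomain NumberField Finset
open scoped MatrixGroups

namespace Literature.NumberTheory.Automorphic

section Representatives

variable {n : ℕ} {K : Type} [Field K] [NumberField K]
  {μ : Measure (AdelicGroupData.gl n K).automorphicQuotient}
  [(AdelicGroupData.gl n K).IsAutomorphicMeasure μ] (v : HeightOneSpectrum (𝓞 K))

/-- **Translates**: if `x =ᵐ F` then `R(h) x =ᵐ F(h⁻¹ • ·)`. [folklore] -/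
theorem rightRegular_ae_eq_comp_inv_smul {x : (AdelicGroupData.gl n K).L2 μ}
    {F : (AdelicGroupData.gl n K).automorphicQuotient → ℂ}
    (hxF : (x : (AdelicGroupData.gl n K).automorphicQuotient → ℂ) =ᵐ[μ] F) (h : (AdelicGroupData.gl n K).Adelic) :
    (((AdelicGroupData.gl n K).rightRegular μ h x : (AdelicGroupData.gl n K).L2 μ) :
        (AdelicGroupData.gl n K).automorphicQuotient → ℂ) =ᵐ[μ] fun y => F (h⁻¹ • y) := by
  filter_upwards [(AdelicGroupData.gl n K).rightRegular_apply_coeFn μ h x, ae_eq_comp_smul hxF h⁻¹]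
    with y h1 h2
  rw [h1]
  exact h2

omit [(AdelicGroupData.gl n K).IsAutomorphicMeasure μ] in
/-- **Finite sums of classes and of their representatives.** [folklore] -/
theorem coeFn_finset_sum_ae_eq {ι : Type*} (s : Finset ι) {x : ι → (AdelicGroupData.gl n K).L2 μ}
    {F : ι → (AdelicGroupData.gl n K).automorphicQuotient → ℂ}
    (h : ∀ i ∈ s, ((x i : (AdelicGroupData.gl n K).L2 μ) : (AdelicGroupData.gl n K).automorphicQuotient → ℂ) =ᵐ[μ] F i) :
    ((∑ i ∈ s, x i : (AdelicGroupData.gl n K).L2 μ) : (AdelicGroupData.gl n K).automorphicQuotient → ℂ) =ᵐ[μ]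
      ∑ i ∈ s, F i := by
  classical
  induction s using Finset.induction_on with
  | empty =>
    simp only [Finset.sum_empty]
    exact Lp.coeFn_zero _ _ _
  | insert a s ha ih =>
    rw [Finset.sum_insert ha, Finset.sum_insert ha]
    filter_upwards [Lp.coeFn_add (x a) (∑ i ∈ s, x i), h a (Finset.mem_insert_self a s),
      ih fun i hi => h i (Finset.mem_insert_of_mem hi)] with y h1 h2 h3
    rw [h1, Pi.add_apply, h2, h3, Pi.add_apply]

/-- **More generally, for any element `h`** (adelic spelling on both sides): if `R(h) z = z` then the
representative satisfies `F(h⁻¹ • y) = F(y)` for EVERY `y`. [folklore] -/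
theorem comp_inv_smul_eq_of_rightRegular_eq_self {z : (AdelicGroupData.gl n K).L2 μ}
    {F : (AdelicGroupData.gl n K).automorphicQuotient → ℂ} (hFc : Continuous F)
    (hzF : (z : (AdelicGroupData.gl n K).automorphicQuotient → ℂ) =ᵐ[μ] F) {h : (AdelicGroupData.gl n K).Adelic}
    (hz : (AdelicGroupData.gl n K).rightRegular μ h z = z) :
    (fun y => F (h⁻¹ • y)) = F := by
  have hae : (fun y => F (h⁻¹ • y)) =ᵐ[μ] F := by
    have h1 := rightRegular_ae_eq_comp_inv_smul (μ := μ) hzF h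
    rw [hz] at h1
    exact h1.symm.trans hzF
  exact (Continuous.ae_eq_iff_eq μ (hFc.comp (continuous_const_smul _)) hFc).1 hae


variable [MeasurableSpace (GL (Fin n) (AdeleRing (𝓞 K) K))]

omit [(AdelicGroupData.gl n K).IsAutomorphicMeasure μ] in
/-- **Right translates by `ι_v(GL_n(K_v))`**: `W_{F(ι_v(X)⁻¹ • ·)}(g) = W_F(g ι_v(X))`. [folklore] -/
theorem whittakerCoeff_invQuot_comp_toAdelic_inv_smul (ν₀ : Measure ↥(adelicUnipotent n K))
    (𝓕 : Set ↥(adelicUnipotent n K)) (ψ : AddChar (AdeleRing (𝓞 K) K) Circle)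
    (F : (AdelicGroupData.gl n K).automorphicQuotient → ℂ) (X : GL (Fin n) (v.adicCompletion K))
    (g : GL (Fin n) (AdeleRing (𝓞 K) K)) :
    whittakerCoeff ν₀ 𝓕 ψ (invQuot (AdelicGroupData.gl n K) fun x => F ((GLn.toAdelic n K v X)⁻¹ • x)) g =
      whittakerCoeff ν₀ 𝓕 ψ (invQuot (AdelicGroupData.gl n K) F) (g * GLn.ofLocal n K v X) := by
  rw [whittakerCoeff_mul_right]
  congr 1

/-- **Invariant vectors have invariant Whittaker coefficients.** If `z ∈ L²` is represented by the
continuous `F` and fixed by `R(ι_v(X))`, then `W_F(g ι_v(X)) = W_F(g)` for every `g`. [folklore] -/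
theorem whittakerCoeff_invQuot_mul_ofLocal_eq_of_rightRegular_eq_self
    (ν₀ : Measure ↥(adelicUnipotent n K)) (𝓕 : Set ↥(adelicUnipotent n K)) (ψ : AddChar (AdeleRing (𝓞 K) K) Circle)
    {z : (AdelicGroupData.gl n K).L2 μ} {F : (AdelicGroupData.gl n K).automorphicQuotient → ℂ}
    (hFc : Continuous F) (hzF : (z : (AdelicGroupData.gl n K).automorphicQuotient → ℂ) =ᵐ[μ] F)
    {X : GL (Fin n) (v.adicCompletion K)} (hz : (AdelicGroupData.gl n K).rightRegular μ (GLn.toAdelic n K v X) z = z)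
    (g : GL (Fin n) (AdeleRing (𝓞 K) K)) :
    whittakerCoeff ν₀ 𝓕 ψ (invQuot (AdelicGroupData.gl n K) F) (g * GLn.ofLocal n K v X) =
      whittakerCoeff ν₀ 𝓕 ψ (invQuot (AdelicGroupData.gl n K) F) g := by
  have hae : (fun y => F ((GLn.toAdelic n K v X)⁻¹ • y)) =ᵐ[μ] F := by
    have h1 := rightRegular_ae_eq_comp_inv_smul (μ := μ) hzF (GLn.toAdelic n K v X)
    rw [hz] at h1
    exact h1.symm.trans hzF
  have heq : (fun y => F ((GLn.toAdelic n K v X)⁻¹ • y)) = F :=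
    (Continuous.ae_eq_iff_eq μ (hFc.comp (continuous_const_smul _)) hFc).1 hae
  rw [← whittakerCoeff_invQuot_comp_toAdelic_inv_smul v, heq]

end Representatives

end Literature.NumberTheory.Automorphic
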